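import Mathlib
import Literature.Analysis.FluidPDE.Tao2016AveragedNS.WeightedLatticeFlows
import Literature.Analysis.FluidPDE.Tao2016AveragedNS.RenormalisedCascadeWaves
import Literature.Analysis.ODE.DampedLatticeContinuation
import HarnessLib

/-!
# Tao 2016, §4: the NS-scaled VISCOUS cascade lattice — global regular solutions from a priori bounds

T. Tao, *Finite time blowup for an averaged three-dimensional Navier–Stokes equation*, J. Amer. Math.
Soc. **29** (2016) 601–674 = arXiv:1402.0290v3, §4: the viscous equation displayed before Theorem 4.2,
`∂ₜX_{i,n} = −ν(1+ε₀)^{2n} X_{i,n} + Σ α (1+ε₀)^{5(n−μ₃)/2} X X` (any table of structure constants,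
any viscosity `ν ≥ 0`), and Lemma 4.1 (4.5), (4.7), (4.11) (a priori weight, one-shell datum, no low
frequencies).  The tree had LOCAL/CONTINUATION theory only for the INVISCID lattice
(`WeightedLatticeFlows`: the conjugated field `weightedField` is Lipschitz on balls of the weighted
sup-norm space); the dissipation `ν(1+ε₀)^{2n}` is UNBOUNDED in `n`, so the viscous lattice is not an
ODE with a Lipschitz field there.  This module supplies the viscous counterpart through the
damping-free Duhamel–Picard scheme of `Literature.Analysis.ODE.DampedLatticePicard` /
`DampedLatticeContinuation` (arbitrary non-negative diagonal damping rates):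

* `weightedField_continuous_along`, `weightedField_frozen_below` — the conjugated field is continuous
  along componentwise-continuous curves and freezes the shells below the datum shell (4.11);
* `exists_viscousGlobal_of_apriori_bound` — **CONTINUATION CRITERION FOR THE VISCOUS LATTICE**: if,
  for admissible weights `w` dominating the (4.5) weight, every regular solution of the `ν`-viscous
  lattice from the one-shell datum `X₀` on any window `[0, s] ⊆ [0, T]` obeys a weighted bound
  `w_k |X_{i,k}| ≤ B(T)`, then a GLOBAL REGULAR viscous solution exists (`ViscousGlobal ε₀ ν α X₀ X`).
  This is the "local well-posedness + continuation" half of any dissipation bootstrap for the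
  viscous lattices (e.g. Barbato–Morandin–Romito-type smoothing arguments); the a priori bound is a
  HYPOTHESIS.

MODEL lattice ODEs only; nothing here is a statement about the Navier–Stokes equations.
-/

noncomputable section

open Set Metric Filter Topology BoundedContinuousFunction

namespace Literature.Analysis.FluidPDE

namespace TaoCascade

variable {m : ℕ}

/-! ### The conjugated field along curves and below the datum shell -/

/-- **Continuity along componentwise-continuous curves.**  The conjugated cascade field evaluated along
a curve `𝓥 : ℝ → (Fin m × ℤ →ᵇ ℝ)` with continuous components has continuous components (each
component is a finite sum of products of two components of the curve).
[cite: Tao2016AveragedNS, §4 (4.8) (the main term is a finite sum over `i₁, i₂ ∈ {1,…,m}` and `μ ∈ S`)] -/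
theorem weightedField_continuous_along {ε₀ A Mα : ℝ} {α : Fin m → Fin m → Fin m → ℤ × ℤ × ℤ → ℝ}
    {w : ℤ → ℝ} (hε : 0 ≤ 1 + ε₀) (hw : WeightRatiosLE ε₀ w A) (hMα : 0 ≤ Mα)
    (hα : ∀ i₁ i₂ i₃ μ, |α i₁ i₂ i₃ μ| ≤ Mα) (𝓥 : ℝ → (Fin m × ℤ →ᵇ ℝ))
    (h𝓥 : ∀ p, Continuous fun t => 𝓥 t p) (p : Fin m × ℤ) :
    Continuous fun t => weightedField hε hw hMα hα (𝓥 t) p := by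
  obtain ⟨i, k⟩ := p
  simp only [weightedField_apply, quadTerm]
  refine continuous_const.mul (continuous_finsetSum _ fun i₁ _ => continuous_finsetSum _ fun i₂ _ =>
    continuous_finsetSum _ fun μ _ => continuous_const.mul ?_)
  exact ((h𝓥 _).div_const _).mul ((h𝓥 _).div_const _)

/-- **No very low frequencies is preserved by the field (4.11).**  If a weighted state vanishes on all
shells `< n₀`, so does the conjugated cascade field: every product in `quadTerm_{i,k}`, `k < n₀`,
contains a factor on a shell `≤ k`. [cite: Tao2016AveragedNS, §4 Lemma 4.1 (4.11)] -/
theorem weightedField_frozen_below {ε₀ A Mα : ℝ} {α : Fin m → Fin m → Fin m → ℤ × ℤ × ℤ → ℝ}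
    {w : ℤ → ℝ} (hε : 0 ≤ 1 + ε₀) (hw : WeightRatiosLE ε₀ w A) (hMα : 0 ≤ Mα)
    (hα : ∀ i₁ i₂ i₃ μ, |α i₁ i₂ i₃ μ| ≤ Mα) (n₀ : ℤ) (T : Fin m × ℤ →ᵇ ℝ)
    (hT : ∀ p ∈ {p : Fin m × ℤ | p.2 < n₀}, T p = 0) :
    ∀ p ∈ {p : Fin m × ℤ | p.2 < n₀}, weightedField hε hw hMα hα T p = 0 := by
  rintro ⟨i, k⟩ hk
  simp only [mem_setOf_eq] at hk
  have h0 : ∀ (j : Fin m) (n : ℤ), n ≤ k → T (j, n) = 0 := fun j n hn =>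
    hT (j, n) (show n < n₀ from lt_of_le_of_lt hn hk)
  rw [weightedField_apply]
  change w k * quadTerm ε₀ α (fun j n (_ : ℝ) => T (j, n) / w n) i k 0 = 0
  rw [quadTerm_four_shifts]
  simp [h0 _ k le_rfl, h0 _ (k - 1) (by linarith)]

/-- `C¹` on `[0,∞)` from a right derivative that is continuous on `[0,∞)` (private helper). [folklore] -/
private theorem contDiffOn_one_Ici_of_hasDerivWithinAt' {f f' : ℝ → ℝ}
    (hf : ∀ t ∈ Ici (0 : ℝ), HasDerivWithinAt f (f' t) (Ici 0) t) (hf' : ContinuousOn f' (Ici 0)) :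
    ContDiffOn ℝ 1 f (Ici 0) := by
  rw [show (1 : WithTop ℕ∞) = 0 + 1 from (zero_add 1).symm,
    contDiffOn_succ_iff_derivWithin (uniqueDiffOn_Ici 0)]
  refine ⟨fun t ht => (hf t ht).differentiableWithinAt, fun h => absurd h (by simp), ?_⟩
  exact contDiffOn_zero.2 (hf'.congr fun t ht => (hf t ht).derivWithin (uniqueDiffOn_Ici 0 t ht))

/-! ### Global regular viscous solutions from a priori weighted bounds -/

/-- **CONTINUATION CRITERION FOR THE NS-SCALED VISCOUS LATTICE.**  Let the weights be admissible
(`WeightRatiosLE ε₀ w A`) with `(1 + (1+ε₀)^{10k})/w_k ≤ D`, the structure constants bounded by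
`M_α`, `ν ≥ 0`, and `X₀` a one-shell datum at shell `0`.  Suppose that for every horizon `T > 0`
there is `B` such that every REGULAR solution of the `ν`-viscous lattice
`∂ₜX_{i,k} = quadTerm_{i,k}(X) − ν(1+ε₀)^{2k}X_{i,k}` from `X₀` on any window `[0,s] ⊆ [0,T]`
(continuous components, no shells below `0`, weighted sup bound finite) obeys `w_k|X_{i,k}(t)| ≤ B` on
`[0,s]` (a priori bound — a HYPOTHESIS).  Then the viscous lattice has a GLOBAL REGULAR solution from
`X₀`: `ViscousGlobal ε₀ ν α X₀ X`.  Duhamel–Picard steps of `ν`-independent length glued under the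
a priori bound (`Literature.Analysis.ODE.exists_dampedFlow_Ici`).
[cite: Tao2016AveragedNS, §4, the viscous equation before Thm. 4.2, with Lemma 4.1 (4.5), (4.7), (4.11); Teschl2012, Cor. 2.16] -/
theorem exists_viscousGlobal_of_apriori_bound {ε₀ ν A Mα D : ℝ}
    {α : Fin m → Fin m → Fin m → ℤ × ℤ × ℤ → ℝ} {w : ℤ → ℝ}
    (hε : 0 ≤ 1 + ε₀) (hw : WeightRatiosLE ε₀ w A) (hMα : 0 ≤ Mα)
    (hα : ∀ i₁ i₂ i₃ μ, |α i₁ i₂ i₃ μ| ≤ Mα)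
    (hD : ∀ k : ℤ, (1 + (1 + ε₀) ^ ((10 : ℝ) * k)) / w k ≤ D) (hν : 0 ≤ ν) (X₀ : Fin m → ℝ)
    (hapriori : ∀ T : ℝ, 0 < T → ∃ B : ℝ, ∀ s ∈ Ioc 0 T, ∀ X : Fin m → ℤ → ℝ → ℝ,
      (∀ i k, X i k 0 = if k = 0 then X₀ i else 0) →
      (∀ i k, k < 0 → ∀ t, X i k t = 0) →
      (∃ M : ℝ, ∀ t i k, w k * |X i k t| ≤ M) →
      (∀ i k, Continuous (X i k)) →
      (∀ i k, ∀ t ∈ Icc 0 s, HasDerivWithinAt (X i k)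
        (quadTerm ε₀ α X i k t - ν * (1 + ε₀) ^ ((2 : ℝ) * k) * X i k t) (Icc 0 s) t) →
      ∀ t ∈ Icc 0 s, ∀ i k, w k * |X i k t| ≤ B) :
    ∃ X : Fin m → ℤ → ℝ → ℝ, ViscousGlobal ε₀ ν α X₀ X := by
  obtain ⟨hwpos, hrat⟩ := id hw
  have hA : 0 ≤ A := le_trans (div_nonneg (Real.rpow_nonneg hε _) (hwpos 0).le) (hrat 0).1
  set F := weightedField hε hw hMα hα with hF
  set c : Fin m × ℤ → ℝ := fun p => ν * (1 + ε₀) ^ ((2 : ℝ) * p.2) with hc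
  have hc0 : ∀ p, 0 ≤ c p := fun p => mul_nonneg hν (Real.rpow_nonneg hε _)
  set J : Set (Fin m × ℤ) := {p | p.2 < 0} with hJ
  -- the weighted datum
  set C₀ : ℝ := w 0 * ∑ i, |X₀ i| with hC₀
  have hC₀b : ∀ p : Fin m × ℤ, ‖w p.2 * (if p.2 = 0 then X₀ p.1 else 0)‖ ≤ C₀ := by
    rintro ⟨i, k⟩
    by_cases hk : k = 0
    · subst hk
      simp only [if_true, Real.norm_eq_abs, abs_mul, abs_of_pos (hwpos 0)]
      exact mul_le_mul_of_nonneg_left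
        (Finset.single_le_sum (fun j _ => abs_nonneg (X₀ j)) (Finset.mem_univ i)) (hwpos 0).le
    · simp only [hk, if_false, mul_zero, norm_zero]
      exact mul_nonneg (hwpos 0).le (Finset.sum_nonneg fun j _ => abs_nonneg _)
  set T₀ : Fin m × ℤ →ᵇ ℝ := ofNormedAddCommGroupDiscrete
    (fun p : Fin m × ℤ => w p.2 * (if p.2 = 0 then X₀ p.1 else 0)) C₀ hC₀b with hT₀
  have hT₀app : ∀ i k, T₀ (i, k) = w k * (if k = 0 then X₀ i else 0) := fun i k => rfl
  have hT₀J : ∀ p ∈ J, T₀ p = 0 := by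
    rintro ⟨i, k⟩ hk
    simp only [hJ, mem_setOf_eq] at hk
    rw [hT₀app, if_neg hk.ne, mul_zero]
  -- the abstract damped flow
  obtain ⟨𝓤, h𝓤0, h𝓤J, h𝓤bd, h𝓤cont, h𝓤d⟩ :=
    Literature.Analysis.ODE.exists_dampedFlow_Ici F c hc0 J
      (fun U hU => weightedField_frozen_below hε hw hMα hα 0 U hU)
      (fun R hR => ⟨8 * (m : ℝ) ^ 2 * Mα * A * R, by positivity, fun U V hU hV p => by
        obtain ⟨i, k⟩ := p
        exact abs_weightedFieldFun_sub_le hε hw hMα hα hR hU hV i k⟩)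
      (fun R hR => ⟨8 * (m : ℝ) ^ 2 * Mα * A * R * R, by positivity, fun U hU p => by
        refine (abs_weightedFieldFun_le hε hw hMα hα U p).trans ?_
        have h1 : 0 ≤ 8 * (m : ℝ) ^ 2 * Mα * A := by positivity
        have h2 : ‖U‖ * ‖U‖ ≤ R * R := mul_le_mul hU hU (norm_nonneg _) hR
        nlinarith⟩)
      (fun R 𝓥 _ h𝓥 p => weightedField_continuous_along hε hw hMα hα 𝓥 h𝓥 p)
      T₀ hT₀J
      (fun T hT => by
        obtain ⟨B, hB⟩ := hapriori T hT
        refine ⟨max B ‖T₀‖, le_max_right _ _, fun s hs 𝓥 h𝓥0 ⟨M, hM⟩ h𝓥J h𝓥c h𝓥d t ht => ?_⟩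
        -- the unweighted family of the competitor
        set X : Fin m → ℤ → ℝ → ℝ := fun i k τ => 𝓥 τ (i, k) / w k with hX
        have hXw : ∀ i k τ, w k * |X i k τ| = |𝓥 τ (i, k)| := fun i k τ => by
          rw [hX]; simp only; rw [abs_div, abs_of_pos (hwpos k), mul_div_cancel₀ _ (hwpos k).ne']
        have hq : ∀ τ i k, quadTerm ε₀ α (fun j n (_ : ℝ) => 𝓥 τ (j, n) / w n) i k 0 =
            quadTerm ε₀ α X i k τ := fun τ i k => rfl
        have hB' := hB s hs X
          (fun i k => by
            rw [hX]; simp only; rw [h𝓥0, hT₀app, mul_div_cancel_left₀ _ (hwpos k).ne'])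
          (fun i k hk τ => by rw [hX]; simp only; rw [h𝓥J τ (i, k) hk, zero_div])
          ⟨M, fun τ i k => by rw [hXw]; exact (Real.norm_eq_abs _ ▸ (𝓥 τ).norm_coe_le_norm (i, k)).trans (hM τ)⟩
          (fun i k => (h𝓥c (i, k)).div_const _)
          (fun i k τ hτ => by
            have h1 := (h𝓥d (i, k) τ hτ).div_const (w k)
            have h2 : (F (𝓥 τ) (i, k) - c (i, k) * 𝓥 τ (i, k)) / w k =
                quadTerm ε₀ α X i k τ - ν * (1 + ε₀) ^ ((2 : ℝ) * k) * X i k τ := by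
              rw [hF, weightedField_apply, hq, sub_div, mul_div_cancel_left₀ _ (hwpos k).ne']
              simp only [hc, hX]
              ring
            rw [h2] at h1
            exact h1)
          t ht
        refine (norm_le (le_trans (norm_nonneg _) (le_max_right _ _))).2 fun p => ?_
        obtain ⟨i, k⟩ := p
        rw [Real.norm_eq_abs, ← hXw]
        exact (hB' i k).trans (le_max_left _ _))
  -- the unweighted global solution
  refine ⟨fun i k t => 𝓤 t (i, k) / w k, ?_⟩
  have hq : ∀ τ i k, quadTerm ε₀ α (fun j n (_ : ℝ) => 𝓤 τ (j, n) / w n) i k 0 =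
      quadTerm ε₀ α (fun i k t => 𝓤 t (i, k) / w k) i k τ := fun τ i k => rfl
  have hval : ∀ i k t, (F (𝓤 t) (i, k) - c (i, k) * 𝓤 t (i, k)) / w k =
      quadTerm ε₀ α (fun i k t => 𝓤 t (i, k) / w k) i k t -
        ν * (1 + ε₀) ^ ((2 : ℝ) * k) * (𝓤 t (i, k) / w k) := by
    intro i k t
    rw [hF, weightedField_apply, hq, sub_div, mul_div_cancel_left₀ _ (hwpos k).ne']
    simp only [hc]
    ring
  have hderiv : ∀ i k, ∀ t ∈ Ici (0 : ℝ), HasDerivWithinAt (fun s => 𝓤 s (i, k) / w k)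
      (quadTerm ε₀ α (fun i k t => 𝓤 t (i, k) / w k) i k t -
        ν * (1 + ε₀) ^ ((2 : ℝ) * k) * (𝓤 t (i, k) / w k)) (Ici 0) t := by
    intro i k t ht
    rw [← hval]
    exact (h𝓤d (i, k) t ht).div_const (w k)
  refine ⟨fun i k => ?_, fun T hT => ?_, fun i k => ?_, fun i k t ht => ?_, fun i k t hk _ => ?_⟩
  · -- `C¹` on `[0, ∞)`
    refine contDiffOn_one_Ici_of_hasDerivWithinAt' (hderiv i k) ?_
    have := (h𝓤cont (i, k)).div_const (w k)
    refine this.congr fun t _ => ?_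
    show _ = (F (𝓤 t) (i, k) - c (i, k) * 𝓤 t (i, k)) / w k
    rw [hval]
  · -- a priori decay (4.5) on `[0, T]`
    obtain ⟨M, hM⟩ := h𝓤bd T hT
    have hM0 : 0 ≤ M := (norm_nonneg _).trans (hM 0 ⟨le_rfl, hT.le⟩)
    refine ⟨D * M, fun t ht i n => ?_⟩
    have h1 : |𝓤 t (i, n) / w n| ≤ M / w n := by
      rw [abs_div, abs_of_pos (hwpos n)]
      exact div_le_div_of_nonneg_right
        ((Real.norm_eq_abs _ ▸ (𝓤 t).norm_coe_le_norm (i, n)).trans (hM t ht)) (hwpos n).le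
    have hpow : 0 ≤ 1 + (1 + ε₀) ^ ((10 : ℝ) * n) := by positivity
    calc (1 + (1 + ε₀) ^ ((10 : ℝ) * n)) * |𝓤 t (i, n) / w n|
        ≤ (1 + (1 + ε₀) ^ ((10 : ℝ) * n)) * (M / w n) := mul_le_mul_of_nonneg_left h1 hpow
      _ = (1 + (1 + ε₀) ^ ((10 : ℝ) * n)) / w n * M := by ring
      _ ≤ D * M := mul_le_mul_of_nonneg_right (hD n) hM0
  · -- the one-shell datum
    show 𝓤 0 (i, k) / w k = _
    rw [h𝓤0, hT₀app, mul_div_cancel_left₀ _ (hwpos k).ne']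
  · -- the viscous motion
    exact (hderiv i k t ht).derivWithin (uniqueDiffOn_Ici 0 t ht)
  · -- no shells below `0`
    show 𝓤 t (i, k) / w k = 0
    rw [h𝓤J t (i, k) (by simpa [hJ] using hk), zero_div]

end TaoCascade

end Literature.Analysis.FluidPDE

end
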